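import Summits.Ventures.CertifiedArithmetic.LowPrec.GemmEnvelopeRowP5

/-!
# GEMM-level envelopes, part (j): the per-vector sliver — `VEC-E4M3` keeps `35/289` up to `2θ` (pub-lowprec gemm gen 22, LXX-j)

HONEST FRAMING: certified error envelopes and provably optimal rounding/accumulation schemes for
low-precision formats under stated cost models; every table by two implementations; no hardware or
vendor claims.

The per-vector E4M3 rows so far assume `κ ≤ 28672` (every non-zero element scaled into the normal range).
Exactly as for the ceil-scaled MX path (`GemmEnvelopeRowP5`: the subnormal top sliver `[17/1152, 1/64)`
keeps the relative atom `1/17`, crossover `θ = 258048/17`), the per-vector path with a covering numerator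
`A ≥ |x|`, scale `A/448`, keeps the atom `1/17` as long as the scaled element `448|x|/A ≥ 448/κ` stays
`≥ 17/1152`, i.e. for `κ ≤ 448·1152/17 = 516096/17 = 2θ ≈ 30358.6` — the FACTOR-TWO LAW: the ideal scale
puts the vector maximum AT `448`, the power-of-two ceil scale puts the block maximum in `(224, 448]`, so the
per-vector datapath at crest factor `κ` sees the same scaled magnitudes as the MX datapath at `κ/2`.
THEOREMS: `vec_rel_error_le_sliver` (atom `1/17` for `κ ≤ 516096/17`), `vecE4M3_blocked_le_sliver`
(GEMM envelope `35/289` on `C(κ)`, `κ ≤ 516096/17`), `row_P2_vecE4M3_le_mxCeil_sliver` (`VEC-E4M3 ≼ MXC` on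
`C(κ)` for `1 ≤ κ ≤ 516096/17`, extending `row_P2_vecE4M3_le_mxCeil`), and `vecE4M3_fails_above`
(for `κ > 516096/17` and blocks of length `≥ 3` the per-vector envelope EXCEEDS `35/289`: masked pair
`a = (448, 0, v, …)`, `b = (0, 448, v, …)`, `v = (136/9 − μ)/1024 ↦ 1/64`, relative GEMM error
`(1/4096 − v²)/v² > 35/289`).  Net for the decision table: the tie `MXC ≈ VEC-E4M3` holds exactly on
`2 ≤ κ ≤ θ`; on `θ < κ ≤ 2θ` only `VEC ≼ MXC`; beyond `2θ` both envelopes exceed `35/289`.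
[cite: MicikeviciusEtAl2022, §3]; [cite: RouhaniEtAl2023MX, §5.1, §6.1]
-/

namespace Summit.Ventures.CertifiedArithmetic.LowPrec.GemmEnvelope

open Finset
open Literature.ComputerArithmetic.FloatingPoint
open Literature.ComputerArithmetic.FloatingPoint.Format
open Literature.ComputerArithmetic.FloatingPoint.MiniFloat
open Literature.ComputerArithmetic.FloatingPoint.MXBlock
open Summit.Ventures.CertifiedArithmetic.LowPrec.SR

/-- Sliver arithmetic, closed form: a positive element scaled into `[17/1152 · X, X/64]` is reproduced as
`X/64` with relative error at most `1/17`. [folklore] -/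
theorem sliver_rel_error_le' {X v : ℚ} (hX : 0 < X) (h1 : 17 / 1152 * X ≤ v) (h2 : v ≤ 1 / 64 * X) :
    |X * (roundNE E4M3 (v / X)).toRat - v| ≤ 1 / 17 * v := by
  have hv : 0 < v := lt_of_lt_of_le (by positivity) h1
  have hr : (roundNE E4M3 (v / X)).toRat = 1 / 64 :=
    toRat_roundNE_E4M3_eq_inv64 (by rw [lt_div_iff₀ hX]; linarith) (by rw [div_le_iff₀ hX]; linarith)
  rw [hr, abs_of_nonneg (by linarith)]
  linarith

/-- PER-VECTOR RELATIVE ATOM INTO THE SLIVER (E4M3, covering numerator `A`, scale `A/448`): on the class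
`v = 0 ∨ A ≤ κ · |v|` with `κ ≤ 516096/17 = 2θ` the scaled element is normal or lies in the top sliver
`[17/1152, 1/64)` of the subnormal band, so the relative error is `≤ 1/17`.  Sharp: `516096/17` is where
`448/κ = 17/1152`. [cite: MicikeviciusEtAl2022, §3] -/
theorem vec_rel_error_le_sliver {A v κ : ℚ} (hv : |v| ≤ A) (hκ : v = 0 ∨ A ≤ κ * |v|)
    (hκM : κ ≤ 516096 / 17) :
    |A / E4M3.maxRat * (roundNE E4M3 (v / (A / E4M3.maxRat))).toRat - v| ≤ 1 / 17 * |v| := by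
  have hM : E4M3.maxRat = 448 := by decide +kernel
  by_cases hv0 : v = 0
  · rw [hv0, scaled_zero]; simp
  have hκ' : A ≤ κ * |v| := hκ.resolve_left hv0
  have hpos : 0 < |v| := abs_pos.mpr hv0
  have hA : 0 < A := lt_of_lt_of_le hpos hv
  rw [hM]
  have hX : 0 < A / 448 := by positivity
  have h1 : κ * |v| ≤ 516096 / 17 * |v| := mul_le_mul_of_nonneg_right hκM hpos.le
  have hy : 17 / 1152 * (A / 448) ≤ |v| := by nlinarith
  by_cases hn : 1 / 64 ≤ |v| / (A / 448)
  · have h := scaled_rel_error_le E4M3 hX (by rw [e4m3_envelope_constants.2.2.2.2.1]; exact hn)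
      (by rw [hM, div_le_iff₀ hX]; linarith)
    rwa [e4m3_envelope_constants.1] at h
  · have h2 : |v| ≤ 1 / 64 * (A / 448) := by
      have hn' := not_le.mp hn
      rw [div_lt_iff₀ hX] at hn'
      exact hn'.le
    have h := sliver_rel_error_le' hX hy h2
    rcases lt_or_gt_of_ne hv0 with hneg | hposv
    · have e : v / (A / 448) = -(|v| / (A / 448)) := by
        rw [abs_of_neg hneg]; ring
      have e2 : A / 448 * -(roundNE E4M3 (|v| / (A / 448))).toRat - v
          = -(A / 448 * (roundNE E4M3 (|v| / (A / 448))).toRat - |v|) := by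
        rw [abs_of_neg hneg]; ring
      rw [e, toRat_roundNE_neg, e2, abs_neg]
      exact h
    · rw [abs_of_pos hposv] at h ⊢
      exact h

/-- PER-VECTOR E4M3 GEMM envelope `35/289` extended to `κ ≤ 516096/17 = 2θ` (exact accumulation).
[cite: MicikeviciusEtAl2022, §3] -/
theorem vecE4M3_blocked_le_sliver {B k : ℕ} (a b : Fin B → Fin k → ℚ) {Aa Ab κ : ℚ}
    (hκ : κ ≤ 516096 / 17)
    (ha : ∀ j i, |a j i| ≤ Aa ∧ (a j i = 0 ∨ Aa ≤ κ * |a j i|))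
    (hb : ∀ j i, |b j i| ≤ Ab ∧ (b j i = 0 ∨ Ab ≤ κ * |b j i|)) :
    |∑ j, ∑ i, (Aa / E4M3.maxRat * (roundNE E4M3 (a j i / (Aa / E4M3.maxRat))).toRat) *
        (Ab / E4M3.maxRat * (roundNE E4M3 (b j i / (Ab / E4M3.maxRat))).toRat)
        - ∑ j, ∑ i, a j i * b j i| ≤ 35 / 289 * ∑ j, ∑ i, |a j i * b j i| := by
  have h := eDec_blocked a b
    (fun j i => Aa / E4M3.maxRat * (roundNE E4M3 (a j i / (Aa / E4M3.maxRat))).toRat)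
    (fun j i => Ab / E4M3.maxRat * (roundNE E4M3 (b j i / (Ab / E4M3.maxRat))).toRat)
    (ua := 1 / 17) (ub := 1 / 17) (γ := 0) (δ := 0)
    (acc := ∑ j, ∑ i, (Aa / E4M3.maxRat * (roundNE E4M3 (a j i / (Aa / E4M3.maxRat))).toRat) *
        (Ab / E4M3.maxRat * (roundNE E4M3 (b j i / (Ab / E4M3.maxRat))).toRat))
    (c := ∑ j, ∑ i, (Aa / E4M3.maxRat * (roundNE E4M3 (a j i / (Aa / E4M3.maxRat))).toRat) *
        (Ab / E4M3.maxRat * (roundNE E4M3 (b j i / (Ab / E4M3.maxRat))).toRat))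
    le_rfl le_rfl (fun j i => vec_rel_error_le_sliver (ha j i).1 (ha j i).2 hκ)
    (fun j i => vec_rel_error_le_sliver (hb j i).1 (hb j i).2 hκ) (by simp) (by simp)
  have e : ((1 : ℚ) / 17 + 1 / 17 + 1 / 17 * (1 / 17)) + 0 * (1 + (1 / 17 + 1 / 17 + 1 / 17 * (1 / 17)))
      + 0 * (1 + (1 / 17 + 1 / 17 + 1 / 17 * (1 / 17))) * (1 + 0) = 35 / 289 := by norm_num
  rw [e] at h
  exact h

/-- **ROW P2 extended, `VEC-E4M3 ≼ MXC` for `1 ≤ κ ≤ 516096/17 = 2θ`**: every `q` bounding the MX error on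
`C(κ)` is `≥ 35/289` (constant blocks approaching `272`), and the per-vector error is `≤ 35/289 · L` up to
`2θ` by the sliver atom. [cite: MicikeviciusEtAl2022, §3]; [cite: RouhaniEtAl2023MX, §6.1] -/
theorem row_P2_vecE4M3_le_mxCeil_sliver {B k : ℕ} (hB : 0 < B) (hk : 0 < k) {κ : ℚ} (hκ1 : 1 ≤ κ)
    (hκ2 : κ ≤ 516096 / 17) (q : ℚ)
    (hY : ∀ (a b : Fin B → Fin k → ℚ) (Aa Ab : ℚ),
      (∀ j i, |a j i| ≤ Aa ∧ (a j i = 0 ∨ Aa ≤ κ * |a j i|)) →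
      (∀ j i, |b j i| ≤ Ab ∧ (b j i = 0 ∨ Ab ≤ κ * |b j i|)) →
      |∑ j, ∑ i, (ceilScale E4M3 (a j) * (roundNE E4M3 (a j i / ceilScale E4M3 (a j))).toRat) *
          (ceilScale E4M3 (b j) * (roundNE E4M3 (b j i / ceilScale E4M3 (b j))).toRat)
          - ∑ j, ∑ i, a j i * b j i| ≤ q * ∑ j, ∑ i, |a j i * b j i|)
    (a b : Fin B → Fin k → ℚ) (Aa Ab : ℚ)
    (ha : ∀ j i, |a j i| ≤ Aa ∧ (a j i = 0 ∨ Aa ≤ κ * |a j i|))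
    (hb : ∀ j i, |b j i| ≤ Ab ∧ (b j i = 0 ∨ Ab ≤ κ * |b j i|)) :
    |∑ j, ∑ i, (Aa / E4M3.maxRat * (roundNE E4M3 (a j i / (Aa / E4M3.maxRat))).toRat) *
        (Ab / E4M3.maxRat * (roundNE E4M3 (b j i / (Ab / E4M3.maxRat))).toRat)
        - ∑ j, ∑ i, a j i * b j i| ≤ q * ∑ j, ∑ i, |a j i * b j i| := by
  obtain ⟨n, rfl⟩ : ∃ n, k = n + 1 := ⟨k - 1, by omega⟩
  have hq : 35 / 289 ≤ q := by
    refine le_of_forall_approach fun x hx1 hx2 => ?_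
    have hx0 : 0 < x := by linarith
    have hmem : ∀ (j : Fin B) (i : Fin (n + 1)), |(fun (_ : Fin B) (_ : Fin (n + 1)) => x) j i| ≤ x ∧
        ((fun (_ : Fin B) (_ : Fin (n + 1)) => x) j i = 0 ∨
          x ≤ κ * |(fun (_ : Fin B) (_ : Fin (n + 1)) => x) j i|) := fun _ _ => by
      refine ⟨by rw [abs_of_pos hx0], Or.inr ?_⟩
      rw [abs_of_pos hx0]; nlinarith
    have hw := hY _ _ x x hmem hmem
    have h288 : ceilScale E4M3 (fun _ : Fin (n + 1) => x) *
        (roundNE E4M3 (x / ceilScale E4M3 (fun _ : Fin (n + 1) => x))).toRat = 288 := by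
      have h := mxCeil_const_eq_288 n hx1 hx2.le (0 : Fin (n + 1)); beta_reduce at h; exact h
    simp only [h288] at hw
    exact (ratio_le_of_const_witness hB (Nat.succ_pos n) (mul_pos hx0 hx0) hw).1
  have hL : 0 ≤ ∑ j, ∑ i, |a j i * b j i| :=
    Finset.sum_nonneg fun j _ => Finset.sum_nonneg fun i _ => abs_nonneg _
  exact le_trans (vecE4M3_blocked_le_sliver a b hκ2 ha hb) (mul_le_mul_of_nonneg_right hq hL)

/-- **PER-VECTOR E4M3 BEYOND `2θ`**: for `516096/17 < κ` and blocks of length `≥ 3` the per-vector envelope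
on `C(κ)` EXCEEDS `35/289`: the masked pair `a = (448, 0, v, …, v)`, `b = (0, 448, v, …, v)` with numerators
`448` (scale `1`), `v = (136/9 − μ)/1024 ↦ 1/64`, `μ = min (1/20) ((136 κ/9 − 458752)/κ)`, has relative
GEMM error `(1/4096 − v²)/v² > 35/289`. [cite: MicikeviciusEtAl2022, §3] -/
theorem vecE4M3_fails_above {B k : ℕ} (hB : 0 < B) (hk : 3 ≤ k) {κ : ℚ} (hκ1 : 516096 / 17 < κ) :
    ∃ (a b : Fin B → Fin k → ℚ) (Aa Ab : ℚ),
      (∀ j i, |a j i| ≤ Aa ∧ (a j i = 0 ∨ Aa ≤ κ * |a j i|)) ∧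
      (∀ j i, |b j i| ≤ Ab ∧ (b j i = 0 ∨ Ab ≤ κ * |b j i|)) ∧
      35 / 289 * ∑ j, ∑ i, |a j i * b j i| <
      |∑ j, ∑ i, (Aa / E4M3.maxRat * (roundNE E4M3 (a j i / (Aa / E4M3.maxRat))).toRat) *
          (Ab / E4M3.maxRat * (roundNE E4M3 (b j i / (Ab / E4M3.maxRat))).toRat)
          - ∑ j, ∑ i, a j i * b j i| := by
  obtain ⟨n, rfl⟩ : ∃ n, k = n + 3 := ⟨k - 3, by omega⟩
  have hM : E4M3.maxRat = 448 := by decide +kernel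
  have hκpos : 0 < κ := by linarith
  -- the witness parameters
  set μ : ℚ := min (1 / 20) ((κ * (136 / 9) - 458752) / κ) with hμdef
  have hμpos : 0 < μ := lt_min (by norm_num) (div_pos (by linarith) hκpos)
  have hμle : μ ≤ 1 / 20 := min_le_left _ _
  have hμκ : μ * κ ≤ κ * (136 / 9) - 458752 := by
    have := min_le_right (1 / 20 : ℚ) ((κ * (136 / 9) - 458752) / κ)
    rwa [le_div_iff₀ hκpos] at this
  set v : ℚ := (136 / 9 - μ) / 1024 with hvdef
  have hv0 : 0 < v := by rw [hvdef]; apply div_pos _ (by norm_num); linarith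
  have hv15 : 15 / 1024 < v := by rw [hvdef, lt_div_iff₀ (by norm_num : (0:ℚ) < 1024)]; linarith
  have hv16 : v ≤ 1 / 64 := by rw [hvdef, div_le_iff₀ (by norm_num : (0:ℚ) < 1024)]; linarith
  have hvM : v ≤ 448 := by linarith
  have hκv : 448 ≤ κ * v := by
    rw [hvdef]
    have : (448 : ℚ) * 1024 ≤ κ * (136 / 9 - μ) := by nlinarith
    rw [mul_div_assoc', le_div_iff₀ (by norm_num : (0:ℚ) < 1024)]
    linarith
  have hκM : (448 : ℚ) ≤ κ * 448 := by nlinarith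
  have h64 : (roundNE E4M3 v).toRat = 1 / 64 := toRat_roundNE_E4M3_eq_inv64 hv15 hv16
  have h448 : (roundNE E4M3 448).toRat = 448 := by decide +kernel
  have hpos448 : (0 : ℚ) < 448 := by norm_num
  -- the blocks
  set a' : Fin (n + 3) → ℚ := Fin.cases (448 : ℚ) (Fin.cases (0 : ℚ) (fun _ : Fin (n + 1) => v)) with ha'
  set b' : Fin (n + 3) → ℚ := Fin.cases (0 : ℚ) (Fin.cases (448 : ℚ) (fun _ : Fin (n + 1) => v)) with hb'
  have haM : ∀ i, |a' i| ≤ 448 := by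
    intro i; rw [ha']
    refine Fin.cases ?_ (fun i' => Fin.cases ?_ (fun _ => ?_) i') i
    · simp only [Fin.cases_zero]; rw [abs_of_pos hpos448]
    · simp only [Fin.cases_succ, Fin.cases_zero, abs_zero]; exact hpos448.le
    · simp only [Fin.cases_succ]; rwa [abs_of_pos hv0]
  have hbM : ∀ i, |b' i| ≤ 448 := by
    intro i; rw [hb']
    refine Fin.cases ?_ (fun i' => Fin.cases ?_ (fun _ => ?_) i') i
    · simp only [Fin.cases_zero, abs_zero]; exact hpos448.le
    · simp only [Fin.cases_succ, Fin.cases_zero]; rw [abs_of_pos hpos448]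
    · simp only [Fin.cases_succ]; rwa [abs_of_pos hv0]
  have hmemA : ∀ (j : Fin B) (i : Fin (n + 3)), |(fun _ : Fin B => a') j i| ≤ 448 ∧
      ((fun _ : Fin B => a') j i = 0 ∨ (448 : ℚ) ≤ κ * |(fun _ : Fin B => a') j i|) := by
    intro j i; refine ⟨haM i, ?_⟩
    show a' i = 0 ∨ (448 : ℚ) ≤ κ * |a' i|
    rw [ha']
    refine Fin.cases ?_ (fun i' => Fin.cases ?_ (fun _ => ?_) i') i
    · simp only [Fin.cases_zero]; rw [abs_of_pos hpos448]; exact Or.inr hκM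
    · simp only [Fin.cases_succ, Fin.cases_zero]
      first | exact Or.inl rfl | exact Or.inl trivial
    · simp only [Fin.cases_succ]; rw [abs_of_pos hv0]; exact Or.inr hκv
  have hmemB : ∀ (j : Fin B) (i : Fin (n + 3)), |(fun _ : Fin B => b') j i| ≤ 448 ∧
      ((fun _ : Fin B => b') j i = 0 ∨ (448 : ℚ) ≤ κ * |(fun _ : Fin B => b') j i|) := by
    intro j i; refine ⟨hbM i, ?_⟩
    show b' i = 0 ∨ (448 : ℚ) ≤ κ * |b' i|
    rw [hb']
    refine Fin.cases ?_ (fun i' => Fin.cases ?_ (fun _ => ?_) i') i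
    · simp only [Fin.cases_zero]
      first | exact Or.inl rfl | exact Or.inl trivial
    · simp only [Fin.cases_succ, Fin.cases_zero]; rw [abs_of_pos hpos448]; exact Or.inr hκM
    · simp only [Fin.cases_succ]; rw [abs_of_pos hv0]; exact Or.inr hκv
  -- the scale is `448/448 = 1`
  have hs : (448 : ℚ) / E4M3.maxRat = 1 := by rw [hM]; norm_num
  -- the three block sums
  have hS1 : ∑ i, (roundNE E4M3 (a' i)).toRat * (roundNE E4M3 (b' i)).toRat
      = ((n + 1 : ℕ) : ℚ) * (1 / 64 * (1 / 64)) := by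
    rw [Fin.sum_univ_succ, Fin.sum_univ_succ, ha', hb']
    simp only [Fin.cases_zero, Fin.cases_succ, h64, h448, toRat_roundNE_zero, mul_zero, zero_mul,
      zero_add, sum_const, card_univ, Fintype.card_fin, nsmul_eq_mul]
  have hS2 : ∑ i, a' i * b' i = ((n + 1 : ℕ) : ℚ) * (v * v) := by
    rw [Fin.sum_univ_succ, Fin.sum_univ_succ, ha', hb']
    simp only [Fin.cases_zero, Fin.cases_succ, mul_zero, zero_mul, zero_add, sum_const, card_univ,
      Fintype.card_fin, nsmul_eq_mul]
  have hS3 : ∑ i, |a' i * b' i| = ((n + 1 : ℕ) : ℚ) * (v * v) := by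
    rw [Fin.sum_univ_succ, Fin.sum_univ_succ, ha', hb']
    simp only [Fin.cases_zero, Fin.cases_succ, mul_zero, zero_mul, abs_zero, zero_add, sum_const,
      card_univ, Fintype.card_fin, nsmul_eq_mul, abs_of_pos (mul_pos hv0 hv0)]
  refine ⟨fun _ => a', fun _ => b', 448, 448, hmemA, hmemB, ?_⟩
  simp only [hs, div_one, one_mul, hS1, hS2, hS3, sum_const, card_univ, Fintype.card_fin, nsmul_eq_mul]
  have hBn : (0 : ℚ) < (B : ℚ) * ((n + 1 : ℕ) : ℚ) := by
    have : (0 : ℚ) < (B : ℚ) := by exact_mod_cast hB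
    positivity
  have hvv : v * v < 289 / 1327104 := by nlinarith
  have hcore : 35 / 289 * (v * v) < 1 / 64 * (1 / 64) - v * v := by linarith
  rw [abs_of_pos (by nlinarith [mul_lt_mul_of_pos_left hcore hBn])]
  nlinarith [mul_lt_mul_of_pos_left hcore hBn]

/-- The factor-two law behind the thresholds: `516096/17 = 2 · (258048/17)` and `448/(516096/17) = 17/1152`
(the sliver edge), `224/(258048/17) = 17/1152`. -/
theorem vec_sliver_threshold_identity :
    (516096 : ℚ) / 17 = 2 * (258048 / 17) ∧ (448 : ℚ) / (516096 / 17) = 17 / 1152 ∧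
    (224 : ℚ) / (258048 / 17) = 17 / 1152 := by norm_num

end Summit.Ventures.CertifiedArithmetic.LowPrec.GemmEnvelope
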